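import Mathlib.MeasureTheory.Integral.Bochner.Basic
import Mathlib.Analysis.Calculus.ContDiff.Basic
import Mathlib.Analysis.Calculus.FDeriv.Add
import Mathlib.Analysis.Calculus.FDeriv.Mul
import Mathlib.Analysis.Calculus.Deriv.Basic
import Mathlib.MeasureTheory.Integral.Bochner.Set
import Mathlib.Analysis.InnerProductSpace.PiL2
import Mathlib.Analysis.InnerProductSpace.Continuous
import Literature.Analysis.FunctionSpaces.FlatTorus
import Literature.Analysis.FunctionSpaces.TorusCalculus
import HarnessLib

-- provenance: harness21/H21/H21/Prelude/Sobolev/TorusTestFunction.lean @ 85125d2 (interim HEAD d8f2665); M5 mechanical rewrite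
/-!
# Test functions, distributions and weak derivatives on `T^d` and `T^d × [0,T)`
(trunk: Sobolev, concept C3 / notion `distributions_spacetime_torus`)

Following the outline `H21/Outlines/Sobolev.md` (§1 "Space–time distributions", §C3):

* `Torus.smoothSubmodule d F`: the `ℝ`-submodule of smooth functions `T^d → F` (carrier
  `Torus.IsSmooth`; the closure proofs are real, via `ContDiff.add`/`ContDiff.const_smul`);
* `Torus.Distribution d F := ↥(smoothSubmodule d ℝ) →ₗ[ℝ] F`: the *algebraic* dual of
  `C^∞(T^d; ℝ)` with values in `F`. This is a v0 bookkeeping device only (no topology on test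
  functions, hence no continuity requirement); all weak formulations in H21 are explicit integral
  identities against smooth test functions;
* `Torus.Distribution.ofFun f` (`φ ↦ ∫ φ • f`, guarded by integrability of `f`) and
  `Torus.Distribution.partialDeriv i T := -T ∘ ∂ᵢ` (built on the *proved* lemma
  `Torus.IsSmooth.partialDeriv` of `TorusCalculus`);
* weak notions on `T^d`: `Torus.HasWeakPartialDeriv i f g`, `Torus.IsWeaklyDivFree u`;
* space–time test fields on `T^d × [0,T)`: `Torus.IsSpaceTimeTest T ψ` (smooth on all of
  `ℝ × ℝ^d`, vanishing for `t ≥ T'` for some `T' < T`; may be nonzero at `t = 0`, encoding initial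
  data), `Torus.IsSpaceTimeTestIoo` (also vanishing near `t = 0`), `Torus.IsDivFreeTest`, and the
  pairing `Torus.stPairing T u ψ = ∫₀ᵀ ∫_{T^d} ⟪u, ψ⟫`.

Test functions live on all of `ℝ` in time, so their time derivative is the two-sided
`Torus.timeDeriv` (solutions use `Torus.timeDerivWithin`).

The weak predicates do not build in integrability (consumers add it, as Evans/Temam do via
`L¹_loc`/`L²`); the resulting Bochner junk values are documented on each definition, and the
uniqueness/injectivity lemmas assume `[CompleteSpace F]` (otherwise `∫ = 0` identically).

Everything is proved except the two du Bois-Reymond–type uniqueness statements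
`Torus.Distribution.ofFun_injective_on_continuous F` and `Torus.HasWeakPartialDeriv.unique F`,
which are recorded as named facts (`def … : Prop`, Evans §5.2.1). Integration by parts on the
torus enters through the upstream named facts `Torus.integral_partialDeriv_eq_zero` and
`Torus.integral_inner_gradient_eq_neg_integral_mul_divergence` (`TorusCalculus`), taken as
explicit hypotheses `hibp` in `IsSmooth.hasWeakPartialDeriv`, `Distribution.partialDeriv_ofFun`
and `IsDivFree.isWeaklyDivFree`.

## Mathlib

Mathlib has bundled test functions and distributions on open subsets of normed spaces
(`Mathlib/Analysis/Distribution/`: `TestFunction`, `Distribution`), but nothing on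
`AddCircle`/`UnitAddTorus` (no `ContDiff` there), and no `ofFun` embedding yet; the periodic
setting is therefore expressed through the lift `Torus.lift` of `FlatTorus`. Integrability of
`φ • f` for smooth `φ` and integrable `f` is Mathlib's `Integrable.smul_of_top_right`.

## References

* L. C. Evans, *Partial Differential Equations* (2nd ed., 2010), §5.2.1 (weak derivatives,
  Def. and uniqueness), App. C.2 Thm. 2 (integration by parts).
* R. Temam, *Navier–Stokes Equations* (3rd ed., 1984), Ch. I §1.4 and Ch. III §1.1 (weak
  divergence-free fields, space–time weak formulation with test functions vanishing near `T`).
* C. Fefferman, *Existence and smoothness of the Navier–Stokes equation* (Clay, 2000/2006),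
  eqs. (8)–(11) (periodic setting).
* L. Grafakos, *Classical Fourier Analysis* (3rd ed., 2014), §3.1 (`C^∞(T^n)`).
-/

open MeasureTheory Set Topology
open scoped ContDiff InnerProductSpace

namespace Literature.Analysis.FunctionSpaces

noncomputable section

namespace Torus

variable {d : Type*} [Fintype d] [DecidableEq d]
variable {F : Type*} [NormedAddCommGroup F] [NormedSpace ℝ F]

/-! ## Smooth functions as a submodule; algebraic distributions -/

section Smooth

omit [DecidableEq d]

variable (d F) in
/-- The `ℝ`-submodule `C^∞(T^d; F)` of smooth functions on the flat torus (carrier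
`Torus.IsSmooth`, i.e. the periodic lift is `C^∞`; Grafakos, §3.1). [folklore] -/
def smoothSubmodule : Submodule ℝ (UnitAddTorus d → F) where
  carrier := {f | IsSmooth f}
  add_mem' hf hg := IsSmooth.add hf hg
  zero_mem' := isSmooth_const (0 : F)
  smul_mem' c _ hf := IsSmooth.smul c hf

/-- Membership in `smoothSubmodule` is smoothness. [folklore] -/
@[simp]
theorem mem_smoothSubmodule {f : UnitAddTorus d → F} : f ∈ smoothSubmodule d F ↔ IsSmooth f :=
  Iff.rfl

variable (d F) in
/-- `F`-valued distributions on `T^d`, v0 version: the *algebraic* dual of the real smooth test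
functions, `C^∞(T^d; ℝ) →ₗ[ℝ] F` (no continuity is imposed since test functions carry no topology
in v0; outline `Sobolev.md` §1, "Space–time distributions"). For bookkeeping only; weak
formulations are stated as explicit integral identities (Evans, §5.2.1). [folklore] -/
abbrev Distribution : Type _ :=
  ↥(smoothSubmodule d ℝ) →ₗ[ℝ] F

/-- For smooth `φ : T^d → ℝ` and integrable `f : T^d → F`, `φ • f` is integrable
(Mathlib `Integrable.smul_of_top_right`, `φ ∈ L^∞` on the compact torus). [folklore] -/
theorem IsSmooth.integrable_smul {φ : UnitAddTorus d → ℝ} (hφ : IsSmooth φ) {f : UnitAddTorus d → F}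
    (hf : Integrable f volume) : Integrable (fun x => φ x • f x) volume :=
  hf.smul_of_top_right (hφ.memLp ⊤)

namespace Distribution

/-- The distribution `T_f : φ ↦ ∫_{T^d} φ x • f x` represented by a function `f : T^d → F`
(Evans, §5.2.1). Junk value: if `f` is not integrable, `ofFun f = 0` (linearity in `φ` needs
integrability of `f`; see `ofFun_apply`). The case split uses classical decidability. [folklore] -/
def ofFun (f : UnitAddTorus d → F) : Distribution d F :=
  haveI := Classical.dec (Integrable f volume)
  if hf : Integrable f volume then
    { toFun := fun φ => ∫ x, (φ : UnitAddTorus d → ℝ) x • f x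
      map_add' := fun φ ψ => by
        simp only [Submodule.coe_add, Pi.add_apply, add_smul]
        exact integral_add (IsSmooth.integrable_smul φ.2 hf) (IsSmooth.integrable_smul ψ.2 hf)
      map_smul' := fun c φ => by
        simp only [Submodule.coe_smul, Pi.smul_apply, smul_eq_mul, mul_smul, RingHom.id_apply]
        exact integral_smul c _ }
  else 0

/-- For integrable `f`, `ofFun f φ = ∫ φ • f`. [folklore] -/
theorem ofFun_apply {f : UnitAddTorus d → F} (hf : Integrable f volume)
    (φ : smoothSubmodule d ℝ) : ofFun f φ = ∫ x, (φ : UnitAddTorus d → ℝ) x • f x := by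
  rw [ofFun, dif_pos hf]
  rfl

/-- For non-integrable `f`, `ofFun f = 0` (junk value). [folklore] -/
theorem ofFun_of_not_integrable {f : UnitAddTorus d → F} (hf : ¬Integrable f volume) :
    ofFun f = 0 := by
  rw [ofFun, dif_neg hf]

/-- `f ↦ T_f` is injective on continuous functions (du Bois-Reymond lemma on the torus;
Evans, §5.2.1, uniqueness of weak derivatives). Completeness of `F` is required: on a
non-complete codomain Mathlib's Bochner integral is identically `0`
(`MeasureTheory.integral_of_not_completeSpace`), so `ofFun` would be constant. Named fact (no
proof here): the `T^d`, `F`-valued, continuous form of the fundamental lemma of the calculus of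
variations behind Evans's uniqueness lemma, with `F` explicit and `f`, `g` quantified inside. [cite: Evans2010, §5.2.1 Lemma (Uniqueness of weak derivatives)] -/
def ofFun_injective_on_continuous (F : Type*) [NormedAddCommGroup F] [NormedSpace ℝ F]
    [CompleteSpace F] : Prop :=
  ∀ ⦃f g : UnitAddTorus d → F⦄, Continuous f → Continuous g → ofFun f = ofFun g → f = g

end Distribution

end Smooth

/-! ## Linearity of partial derivatives; distributional partial derivatives -/

section PartialDeriv

omit [DecidableEq d] in
/-- Additivity of the torus Fréchet derivative for `C¹` functions (Mathlib `fderiv_add` on the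
re-centred lifts). [folklore] -/
theorem fderiv_add {f g : UnitAddTorus d → F} (hf : IsContDiff 1 f) (hg : IsContDiff 1 g)
    (x : UnitAddTorus d) : Torus.fderiv (f + g) x = Torus.fderiv f x + Torus.fderiv g x := by
  unfold Torus.fderiv
  rw [show liftAt (f + g) x = liftAt f x + liftAt g x from rfl]
  exact _root_.fderiv_add ((hf.liftAt x).differentiable one_ne_zero).differentiableAt
    ((hg.liftAt x).differentiable one_ne_zero).differentiableAt

omit [DecidableEq d] in
/-- Homogeneity of the torus Fréchet derivative for `C¹` functions (Mathlib
`fderiv_const_smul` on the re-centred lift). [folklore] -/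
theorem fderiv_const_smul {f : UnitAddTorus d → F} (hf : IsContDiff 1 f) (c : ℝ)
    (x : UnitAddTorus d) : Torus.fderiv (c • f) x = c • Torus.fderiv f x := by
  unfold Torus.fderiv
  rw [show liftAt (c • f) x = c • liftAt f x from rfl]
  exact _root_.fderiv_const_smul ((hf.liftAt x).differentiable one_ne_zero).differentiableAt c

/-- `∂ᵢ (f + g) = ∂ᵢ f + ∂ᵢ g` for `C¹` functions on the torus. [folklore] -/
theorem partialDeriv_add {f g : UnitAddTorus d → F} (hf : IsContDiff 1 f) (hg : IsContDiff 1 g)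
    (i : d) : partialDeriv i (f + g) = partialDeriv i f + partialDeriv i g := by
  funext x
  rw [Pi.add_apply, partialDeriv_eq_fderiv_apply (hf.add hg), partialDeriv_eq_fderiv_apply hf,
    partialDeriv_eq_fderiv_apply hg, fderiv_add hf hg, FunLike.coe_add, Pi.add_apply]

/-- `∂ᵢ (c • f) = c • ∂ᵢ f` for `C¹` functions on the torus. [folklore] -/
theorem partialDeriv_const_smul {f : UnitAddTorus d → F} (hf : IsContDiff 1 f) (c : ℝ) (i : d) :
    partialDeriv i (c • f) = c • partialDeriv i f := by
  funext x
  rw [Pi.smul_apply, partialDeriv_eq_fderiv_apply (hf.smul c), partialDeriv_eq_fderiv_apply hf,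
    fderiv_const_smul hf, FunLike.coe_smul, Pi.smul_apply]

/-- Product rule `∂ᵢ (φ • f) = ∂ᵢφ • f + φ • ∂ᵢ f` for a `C¹` scalar `φ` and a `C¹` vector
function `f` on the torus (Mathlib `fderiv_smul` on the re-centred lifts). [folklore] -/
theorem partialDeriv_smul' {φ : UnitAddTorus d → ℝ} {f : UnitAddTorus d → F} (hφ : IsContDiff 1 φ)
    (hf : IsContDiff 1 f) (i : d) (x : UnitAddTorus d) :
    partialDeriv i (fun y => φ y • f y) x =
      partialDeriv i φ x • f x + φ x • partialDeriv i f x := by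
  have hφf : IsContDiff 1 (fun y => φ y • f y) := ContDiff.smul hφ hf
  rw [partialDeriv_eq_fderiv_apply hφf, partialDeriv_eq_fderiv_apply hφ,
    partialDeriv_eq_fderiv_apply hf]
  unfold Torus.fderiv
  rw [show liftAt (fun y => φ y • f y) x = fun v => liftAt φ x v • liftAt f x v from rfl,
    _root_.fderiv_fun_smul ((hφ.liftAt x).differentiable one_ne_zero).differentiableAt
      ((hf.liftAt x).differentiable one_ne_zero).differentiableAt]
  rw [FunLike.coe_add, Pi.add_apply, FunLike.coe_smul, Pi.smul_apply,
    ContinuousLinearMap.smulRight_apply, liftAt_apply_zero, liftAt_apply_zero, add_comm]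

variable (F) in
/-- The `i`-th partial derivative as an `ℝ`-linear endomorphism of `C^∞(T^d; F)`
(uses the proved `IsSmooth.partialDeriv` of `TorusCalculus`; Grafakos, §3.1). [folklore] -/
def smoothPartialDeriv (i : d) : smoothSubmodule d F →ₗ[ℝ] smoothSubmodule d F where
  toFun φ := ⟨partialDeriv i (φ : UnitAddTorus d → F), (φ.2 : IsSmooth _).partialDeriv i⟩
  map_add' φ ψ := Subtype.ext <|
    partialDeriv_add ((φ.2 : IsSmooth _).isContDiff (by simp))
      ((ψ.2 : IsSmooth _).isContDiff (by simp)) i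
  map_smul' c φ := Subtype.ext <|
    partialDeriv_const_smul ((φ.2 : IsSmooth _).isContDiff (by simp)) c i

/-- `smoothPartialDeriv F i φ = ∂ᵢ φ` as functions. [folklore] -/
@[simp]
theorem coe_smoothPartialDeriv (i : d) (φ : smoothSubmodule d F) :
    ((smoothPartialDeriv F i φ : smoothSubmodule d F) : UnitAddTorus d → F) =
      partialDeriv i (φ : UnitAddTorus d → F) :=
  rfl

/-- The distributional partial derivative `∂ᵢ T := -T ∘ ∂ᵢ`, i.e.
`(∂ᵢ T)(φ) = -T(∂ᵢ φ)` (Evans, §5.2.1, motivated by integration by parts on `T^d`, where there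
is no boundary term). [folklore] -/
def Distribution.partialDeriv (i : d) (T : Distribution d F) : Distribution d F :=
  -(T ∘ₗ smoothPartialDeriv ℝ i)

/-- `(∂ᵢ T) φ = -T (∂ᵢ φ)`. [folklore] -/
@[simp]
theorem Distribution.partialDeriv_apply (i : d) (T : Distribution d F) (φ : smoothSubmodule d ℝ) :
    T.partialDeriv i φ = -T (smoothPartialDeriv ℝ i φ) :=
  rfl

end PartialDeriv

/-! ## Weak derivatives and weakly divergence-free fields on `T^d` -/

section Weak

/-- `g` is the weak `i`-th partial derivative of `f` on `T^d`: for every smooth real test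
function `φ`, `∫ ∂ᵢφ • f = -∫ φ • g` (Evans, §5.2.1, Definition; on the torus there is no
boundary and no support condition). Junk values: no integrability of `f`, `g` is built in
(Evans assumes `L¹_loc`; consumers add `Integrable`/`MemLp` hypotheses), so by the Bochner
convention `∫ = 0` the predicate is insensitive to non-integrable data, and it degenerates
(holds for all `f g`) when `F` is not complete. Meaningful uses take `F` complete and `f g`
integrable. [folklore] -/
def HasWeakPartialDeriv (i : d) (f g : UnitAddTorus d → F) : Prop :=
  ∀ φ : UnitAddTorus d → ℝ, IsSmooth φ → ∫ x, partialDeriv i φ x • f x = -∫ x, φ x • g x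

omit [DecidableEq d] in
/-- A vector field `u : T^d → ℝ^d` is weakly divergence free: `∫ ⟪u, ∇θ⟫ = 0` for every smooth
scalar `θ` (Temam, Ch. I §1.4, the space `H`; Fefferman, eq. (2) in weak form). Junk value:
integrability of `u` is not built in (Temam works in `L²`; consumers add it), so for
non-integrable `⟪u, ∇θ⟫` the Bochner convention `∫ = 0` makes the condition vacuous. [folklore] -/
def IsWeaklyDivFree (u : UnitAddTorus d → EuclideanSpace ℝ d) : Prop :=
  ∀ θ : UnitAddTorus d → ℝ, IsSmooth θ → ∫ x, ⟪u x, gradient θ x⟫_ℝ = 0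

/-- Smooth divergence-free fields are weakly divergence free (Temam, Ch. I §1.4), relative to
integration by parts against a gradient on `T^d`, the upstream named fact
`Torus.integral_inner_gradient_eq_neg_integral_mul_divergence` taken as the hypothesis `hibp`. [folklore] -/
theorem IsDivFree.isWeaklyDivFree
    (hibp : integral_inner_gradient_eq_neg_integral_mul_divergence (d := d))
    {u : UnitAddTorus d → EuclideanSpace ℝ d} (hu : IsSmooth u) (h : IsDivFree u) :
    IsWeaklyDivFree u := by
  intro θ hθ
  rw [hibp hu hθ]
  simp [h _]

/-- Weak partial derivatives of an integrable function are unique almost everywhere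
(Evans, §5.2.1, Lemma "uniqueness of weak derivatives"; du Bois-Reymond on `T^d`). Integrability
of the candidates is assumed (on the compact torus, locally integrable = integrable) and `F` is
complete; together these rule out the junk value `∫ = 0` of the Bochner integral
(`MeasureTheory.integral_undef`, `MeasureTheory.integral_of_not_completeSpace`). Named fact (no
proof here): the `T^d`, `F`-valued form of Evans's uniqueness lemma, with `F` explicit and the
data quantified inside. [cite: Evans2010, §5.2.1 Lemma (Uniqueness of weak derivatives)] -/
def HasWeakPartialDeriv.unique (F : Type*) [NormedAddCommGroup F] [NormedSpace ℝ F]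
    [CompleteSpace F] : Prop :=
  ∀ ⦃i : d⦄ ⦃f g g' : UnitAddTorus d → F⦄, Integrable g volume → Integrable g' volume →
    HasWeakPartialDeriv i f g → HasWeakPartialDeriv i f g' → g =ᵐ[volume] g'

/-- For smooth `f`, the classical partial derivative is a weak partial derivative: product rule
`partialDeriv_smul'` and `∫_{T^d} ∂ᵢ (φ • f) = 0`, the latter being the upstream named fact
`Torus.integral_partialDeriv_eq_zero` taken as the hypothesis `hibp` (Evans, §5.2.1, motivation
of the definition). [folklore] -/
theorem IsSmooth.hasWeakPartialDeriv (hibp : integral_partialDeriv_eq_zero (d := d) (F := F))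
    {f : UnitAddTorus d → F} (hf : IsSmooth f) (i : d) :
    HasWeakPartialDeriv i f (Torus.partialDeriv i f) := by
  intro φ hφ
  have h0 := hibp (hφ.smul' hf) i
  have hprod : Torus.partialDeriv i (fun y => φ y • f y) =
      fun y => Torus.partialDeriv i φ y • f y + φ y • Torus.partialDeriv i f y :=
    funext (partialDeriv_smul' (hφ.isContDiff (by simp)) (hf.isContDiff (by simp)) i)
  rw [hprod, integral_add ((hφ.partialDeriv i).integrable_smul hf.integrable)
    (hφ.integrable_smul (hf.partialDeriv i).integrable)] at h0
  exact eq_neg_of_add_eq_zero_left h0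

/-- A weak partial derivative determines the distributional one:
`∂ᵢ T_f = T_g` whenever `g` is an (integrable) weak `i`-th derivative of the integrable `f`. [folklore] -/
theorem HasWeakPartialDeriv.partialDeriv_ofFun {i : d} {f g : UnitAddTorus d → F}
    (hf : Integrable f volume) (hg : Integrable g volume) (h : HasWeakPartialDeriv i f g) :
    (Distribution.ofFun f).partialDeriv i = Distribution.ofFun g := by
  ext φ
  rw [Distribution.partialDeriv_apply, Distribution.ofFun_apply hf, Distribution.ofFun_apply hg,
    coe_smoothPartialDeriv, h _ φ.2, neg_neg]

/-- Consistency: for smooth `f`, the distributional derivative of `T_f` is `T_{∂ᵢ f}`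
(Evans, §5.2.1), relative to integration by parts on the torus (the upstream named fact
`Torus.integral_partialDeriv_eq_zero`, hypothesis `hibp`); from `IsSmooth.hasWeakPartialDeriv`
and `HasWeakPartialDeriv.partialDeriv_ofFun`. [folklore] -/
theorem Distribution.partialDeriv_ofFun (hibp : integral_partialDeriv_eq_zero (d := d) (F := F))
    {f : UnitAddTorus d → F} (hf : IsSmooth f) (i : d) :
    (Distribution.ofFun f).partialDeriv i = Distribution.ofFun (Torus.partialDeriv i f) :=
  (hf.hasWeakPartialDeriv hibp i).partialDeriv_ofFun hf.integrable (hf.partialDeriv i).integrable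

end Weak

/-! ## Space–time test functions on `T^d × [0, T)` -/

section SpaceTime

/-- A space–time vector test field is divergence free if every time slice is
(Temam, Ch. III §1.1, test space `𝒱`). [folklore] -/
def IsDivFreeTest (ψ : ℝ → UnitAddTorus d → EuclideanSpace ℝ d) : Prop :=
  ∀ t, IsDivFree (ψ t)

omit [DecidableEq d]

omit [Fintype d] [NormedAddCommGroup F] [NormedSpace ℝ F] in
/-- A space–time field is jointly continuous on `ℝ × T^d` as soon as its space–time lift is
continuous on `ℝ × ℝ^d` (`id × proj` is an open quotient map, `Torus.isOpenQuotientMap_proj`). [folklore] -/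
theorem continuous_uncurry_of_continuous_stLift {G : Type*} [TopologicalSpace G]
    {u : ℝ → UnitAddTorus d → G} (hu : Continuous (stLift u)) :
    Continuous (Function.uncurry u) :=
  (IsOpenQuotientMap.id.prodMap
    (isOpenQuotientMap_proj (d := d))).continuous_comp_iff.1 hu

/-- Space–time test fields on `T^d × [0,T)`: `ψ : ℝ → T^d → F` whose space–time lift is `C^∞`
on all of `ℝ × ℝ^d` and which vanishes identically for `t ≥ T'`, for some `T' < T` (compact
support in time away from `T`). `ψ 0` may be nonzero: pairing against such `ψ` encodes the
initial datum (Temam, Ch. III §1.1, weak formulation (1.22)–(1.23); Fefferman, (8)–(11)). [folklore] -/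
def IsSpaceTimeTest (T : ℝ) (ψ : ℝ → UnitAddTorus d → F) : Prop :=
  ContDiff ℝ ∞ (stLift ψ) ∧ ∃ T' < T, ∀ t, T' ≤ t → ψ t = 0

/-- Space–time test fields compactly supported in the *open* time interval `(0, T)`: in
addition to `IsSpaceTimeTest`, `ψ t = 0` for all `t ≤ ε`, for some `ε > 0`
(Temam, Ch. III §1.1: distributions on `(0,T)` with values in a function space). [folklore] -/
def IsSpaceTimeTestIoo (T : ℝ) (ψ : ℝ → UnitAddTorus d → F) : Prop :=
  IsSpaceTimeTest T ψ ∧ ∃ ε > (0 : ℝ), ∀ t ≤ ε, ψ t = 0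

/-- The space–time pairing `⟪u, ψ⟫ := ∫_{(0,T)} ∫_{T^d} ⟪u t x, ψ t x⟫ dx dt` of a field `u` with
a test field `ψ`, both with values in a real inner product space (Temam, Ch. III §1.1). Junk
value: no integrability of `u` is built in (consumers assume `u ∈ L²((0,T) × T^d)` or
continuity); non-integrable slices contribute `0` by the Bochner convention. [folklore] -/
def stPairing {G : Type*} [NormedAddCommGroup G] [InnerProductSpace ℝ G] (T : ℝ)
    (u ψ : ℝ → UnitAddTorus d → G) : ℝ :=
  ∫ t in Ioo 0 T, ∫ x, ⟪u t x, ψ t x⟫_ℝ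

/-- The zero field is a space–time test field. [folklore] -/
theorem isSpaceTimeTest_zero (T : ℝ) : IsSpaceTimeTest T (0 : ℝ → UnitAddTorus d → F) :=
  ⟨contDiff_const (c := (0 : F)), T - 1, by linarith, fun _ _ => rfl⟩

/-- Space–time test fields are closed under addition. [folklore] -/
theorem IsSpaceTimeTest.add {T : ℝ} {ψ χ : ℝ → UnitAddTorus d → F} (hψ : IsSpaceTimeTest T ψ)
    (hχ : IsSpaceTimeTest T χ) : IsSpaceTimeTest T (ψ + χ) := by
  obtain ⟨hψs, T₁, hT₁, h₁⟩ := hψ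
  obtain ⟨hχs, T₂, hT₂, h₂⟩ := hχ
  refine ⟨hψs.add hχs, max T₁ T₂, max_lt hT₁ hT₂, fun t ht => ?_⟩
  rw [Pi.add_apply, h₁ t ((le_max_left _ _).trans ht), h₂ t ((le_max_right _ _).trans ht),
    add_zero]

/-- Space–time test fields are closed under scalar multiplication. [folklore] -/
theorem IsSpaceTimeTest.smul {T : ℝ} {ψ : ℝ → UnitAddTorus d → F} (c : ℝ)
    (hψ : IsSpaceTimeTest T ψ) : IsSpaceTimeTest T (c • ψ) := by
  obtain ⟨hψs, T₁, hT₁, h₁⟩ := hψ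
  refine ⟨hψs.const_smul c, T₁, hT₁, fun t ht => ?_⟩
  rw [Pi.smul_apply, h₁ t ht, smul_zero]

/-- The time slices of a space–time test field are smooth. [folklore] -/
theorem IsSpaceTimeTest.isSmooth_slice {T : ℝ} {ψ : ℝ → UnitAddTorus d → F}
    (hψ : IsSpaceTimeTest T ψ) (t : ℝ) : IsSmooth (ψ t) :=
  hψ.1.comp (contDiff_prodMk_right t)

/-- A space–time test field is jointly smooth on every time set `S`. [folklore] -/
theorem IsSpaceTimeTest.isSmoothSpaceTimeOn {T : ℝ} {ψ : ℝ → UnitAddTorus d → F}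
    (hψ : IsSpaceTimeTest T ψ) (S : Set ℝ) : IsSmoothSpaceTimeOn S ψ :=
  hψ.1.contDiffOn

omit [Fintype d] in
/-- The space–time lift of the time derivative is the time-directional Fréchet derivative of the
space–time lift: `stLift (∂ₜψ) (t, y) = D(stLift ψ ( · , y))(t) 1`. [folklore] -/
theorem stLift_timeDeriv (ψ : ℝ → UnitAddTorus d → F) :
    stLift (timeDeriv ψ) =
      fun p : ℝ × EuclideanSpace ℝ d =>
        _root_.fderiv ℝ (fun τ => stLift ψ (τ, p.2)) p.1 (1 : ℝ) := by
  funext p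
  rw [fderiv_apply_one_eq_deriv]
  rfl

/-- The (two-sided) time derivative of a space–time test field is again a space–time test
field (smoothness of partial derivatives, Mathlib `ContDiff.fderiv_apply`; the support condition
is inherited with `T'' = (T' + T)/2 ∈ (T', T)`, since `ψ` vanishes on the open set
`{t | T' < t}`). [folklore] -/
theorem IsSpaceTimeTest.timeDeriv {T : ℝ} {ψ : ℝ → UnitAddTorus d → F}
    (hψ : IsSpaceTimeTest T ψ) : IsSpaceTimeTest T (timeDeriv ψ) := by
  obtain ⟨hs, T', hT', h0⟩ := hψ
  refine ⟨?_, (T' + T) / 2, by linarith, fun t ht => ?_⟩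
  · rw [stLift_timeDeriv]
    refine ContDiff.fderiv_apply (m := ∞)
      (f := fun (p : ℝ × EuclideanSpace ℝ d) (τ : ℝ) => stLift ψ (τ, p.2)) ?_ contDiff_fst
      contDiff_const (le_of_eq rfl)
    exact hs.comp (contDiff_snd.prodMk (contDiff_snd.comp contDiff_fst))
  · funext x
    have h : (fun τ => ψ τ x) =ᶠ[𝓝 t] fun _ => (0 : F) := by
      filter_upwards [Ioi_mem_nhds (show T' < t by linarith)] with τ hτ
      rw [h0 τ (le_of_lt hτ), Pi.zero_apply]
    change deriv (fun τ => ψ τ x) t = 0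
    rw [h.deriv_eq, deriv_const]

/-- Test fields supported in `(0, T)` are in particular test fields on `[0, T)`. [folklore] -/
theorem IsSpaceTimeTestIoo.isSpaceTimeTest {T : ℝ} {ψ : ℝ → UnitAddTorus d → F}
    (hψ : IsSpaceTimeTestIoo T ψ) : IsSpaceTimeTest T ψ :=
  hψ.1

/-- Test fields supported in `(0, T)` vanish at `t = 0`. [folklore] -/
theorem IsSpaceTimeTestIoo.apply_zero {T : ℝ} {ψ : ℝ → UnitAddTorus d → F}
    (hψ : IsSpaceTimeTestIoo T ψ) : ψ 0 = 0 := by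
  obtain ⟨ε, hε, h⟩ := hψ.2
  exact h 0 hε.le

/-- The space–time pairing is additive in the test field, for smooth test fields and a field
`u` that is integrable on `(0,T) × T^d` (stated for continuous `stLift u`, which suffices for
all H21 uses; Temam, Ch. III §1.1). Proof: `inner_add_right`, then `integral_add` in space
(continuous integrands on the compact torus) and in time (the space integrals are continuous in
`t`, Mathlib `continuous_parametric_integral_of_continuous`). [folklore] -/
theorem stPairing_add_right {G : Type*} [NormedAddCommGroup G] [InnerProductSpace ℝ G] {T : ℝ}
    {u ψ χ : ℝ → UnitAddTorus d → G} (hu : Continuous (stLift u)) (hψ : IsSpaceTimeTest T ψ)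
    (hχ : IsSpaceTimeTest T χ) : stPairing T u (ψ + χ) = stPairing T u ψ + stPairing T u χ := by
  have huc := continuous_uncurry_of_continuous_stLift hu
  -- joint continuity of the two integrands `(t, x) ↦ ⟪u t x, ψ t x⟫`, `(t, x) ↦ ⟪u t x, χ t x⟫`
  have hI : ∀ {φ : ℝ → UnitAddTorus d → G}, IsSpaceTimeTest T φ →
      Continuous (Function.uncurry fun t x => ⟪u t x, φ t x⟫_ℝ) := fun hφ =>
    huc.inner (continuous_uncurry_of_continuous_stLift hφ.1.continuous)
  -- integrability in space at fixed time, and of the space integral in time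
  have hIx : ∀ {φ : ℝ → UnitAddTorus d → G}, IsSpaceTimeTest T φ → ∀ t : ℝ,
      Integrable (fun x => ⟪u t x, φ t x⟫_ℝ) volume := fun hφ t =>
    ((hI hφ).comp (Continuous.prodMk_right t)).integrable_unitAddTorus
  have hIt : ∀ {φ : ℝ → UnitAddTorus d → G}, IsSpaceTimeTest T φ →
      IntegrableOn (fun t => ∫ x, ⟪u t x, φ t x⟫_ℝ) (Ioo 0 T) volume := fun {φ} hφ => by
    have hc : Continuous fun t => ∫ x, ⟪u t x, φ t x⟫_ℝ := by
      simpa only [Measure.restrict_univ] using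
        continuous_parametric_integral_of_continuous (μ := (volume : Measure (UnitAddTorus d)))
          (hI hφ) isCompact_univ
    exact (hc.continuousOn.integrableOn_compact isCompact_Icc).mono_set Ioo_subset_Icc_self
  unfold stPairing
  rw [← integral_add (hIt hψ) (hIt hχ)]
  refine setIntegral_congr_fun measurableSet_Ioo fun t _ => ?_
  rw [← integral_add (hIx hψ t) (hIx hχ t)]
  refine integral_congr_ae (ae_of_all _ fun x => ?_)
  simp only [Pi.add_apply, inner_add_right]

end SpaceTime

end Torus

end

end Literature.Analysis.FunctionSpaces
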